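import Summits.BirchSwinnertonDyer.BirchSwinnertonDyer.Theorems.KimAtThreeShallowEqDeepAnomalousCongruence
import HarnessLib

/-!
# Route `KimAtThreeKolyvagin` (W2): the FACTORED derivative congruence from `ZetaBody` at a tame level
# (value side of the Kato–Kurihara port on the good ANOMALOUS rows at `3`, file 2)

Cell `bsd-addord`, seat `bsd-addord-w2-c4` (gen 9; owner of crux 19599 `ShallowEqDeepOffKatoStratum`, item
19077 `ShallowEqDeepAtTorsionFree`).  `--supports` 19599.  HONEST FRAMING: ONE TOOL THEOREM (no definition,
no named fact, no instance, no `sorry`); Kato's cited matrix `ZetaBody` enters as the displayed HYPOTHESIS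
`hbody` (never obtained); nothing is booked; 19599 / 19077 / 19560 stay OPEN; BSD is not proved by any of this.
Credit: n1011-p15's `EulerFactorComparison.prod_deriv_mul_plusAvatar_sub_mem_map_span_of_zetaBody` — this
file is that wrapper VERBATIM (value law from `hbody` by PK-4a `ZetaValueCharSum.charSum_eq_of_even`,
integrality of the symbols, `ℓ_q ∤ N`, `(pA, n) = 1`, `a_{ℓ_q} ∈ ℤ`, the lifts `λ_q`), calling the seat's
FACTORED congruence `KimAtThreeShallowEqDeepAnomalousCongruence.prod_deriv_mul_plusAvatar_sub_eq_factor_mul`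
(the twist `Vq` factored as `c₁ • Vq = P_ℚ · Vq′` with integral lifts `P`, `V′`; the `p`-Euler factor `P`
SURVIVES on the right: `∏D · (((c₁·n)•(1+δ₋₁)X)^{ℚ_p} − (Θ·(P·V′))^{ℚ_p}) = (P·Y)^{ℚ_p}`, `Y ∈ p^K ℤ_p[(ℤ/n)ˣ]`)
instead of the lifted one.  WHY (the anomalous rows, `a₃ ∈ {1, −2}`): module docstring of the companion —
the semi-local dual-exponential lattice is the Euler-factor lattice `E_p(φ⁻¹)·𝓞_K`, so the congruence must
be read in `P · p^K ℤ_p[(ℤ/n)ˣ]`, not in `p^K ℤ_p[(ℤ/n)ˣ]`.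

References: K. Kato, Astérisque 295 (2004) Thm. 6.6 (1) p. 163, §6.2 p. 161, Thm. 9.7 p. 189
[Kato2004Asterisque]; C.-H. Kim, AJM 148 (2026) = arXiv:2203.12159, the proof of Thm. 3.13
[Kim2022StructureSelmer]; K. Rubin, *Euler Systems* (2000) §4.4, §9.6 [Rubin2000].
-/

noncomputable section

-- the Theorems namespace of a single-conjunct summit repeats the summit name by design (D-0017)
set_option linter.dupNamespace false

open scoped BigOperators NumberField TensorProduct
open Finset IsDedekindDomain NumberField MonoidAlgebra CongruenceSubgroup
open Literature.NumberTheory.GaloisRepresentations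
open Literature.NumberTheory.EllipticCurves Literature.NumberTheory.EllipticCurves.ModularForms
open Literature.NumberTheory.EllipticCurves.Kato2004
open Literature.NumberTheory.EllipticCurves.Kato2004.EulerSystemValues Rat.HeightOneSpectrum
open Summit.BirchSwinnertonDyer.Rank1Residual.GaloisImage
open Summit.BirchSwinnertonDyer.Rank1Residual.GaloisImage.EulerFactorComparison
open Summit.BirchSwinnertonDyer.BirchSwinnertonDyer.Theorems.KimAtThreeShallowEqDeepAnomalousCongruence

namespace Summit.BirchSwinnertonDyer.BirchSwinnertonDyer.Theorems.KimAtThreeShallowEqDeepAnomalousCongruenceOfZetaBody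

/-! ### From `ZetaBody`, at the tame level `n = cycLevel p 0 r`, place-indexed -/

section OfZetaBody

variable {W : WeierstrassCurve ℚ} [W.IsElliptic] [W.IsGloballyMinimal] {p : ℕ} [Fact p.Prime]
  [ContinuousSMul ℤ_[p] (W.tateModule p)] [Module.Free ℤ_[p] (W.tateModule p)]
  [Module.Finite ℤ_[p] (W.tateModule p)] {N : ℕ} [NeZero N] {f : CuspForm (Gamma0 N) 2}
  {ι : (m : ℕ) → (CyclotomicField m ℚ →+* ℂ)} {κ : ℝ}
  {Λ : ∀ (k : ℕ) (r : Finset (HeightOneSpectrum (𝓞 ℚ))),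
    H1 (tateRep W p) (cycSubgroup p k r) →ₗ[ℤ_[p]] ℚ_[p] ⊗[ℚ] CyclotomicField (cycLevel p k r) ℚ}
  {c d a : ℤ} {A : ℕ} [NeZero A]
  {z : ∀ (k : ℕ) (r : (cyclotomicLevelsRat p (badPlaces c d A N)).Ideals),
    H1 (tateRep W p) ((cyclotomicLevelsRat p (badPlaces c d A N)).level k r.1)}
  {x : ∀ (k : ℕ) (r : (cyclotomicLevelsRat p (badPlaces c d A N)).Ideals),
    CyclotomicField (cycLevel p k r.1) ℚ}

set_option backward.isDefEq.respectTransparency false in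
/-- **★★ THE FACTORED CONGRUENCE from `ZetaBody`, at the tame level `n = cycLevel p 0 r`, place-indexed.**
n1011-p15's `prod_deriv_mul_plusAvatar_sub_mem_map_span_of_zetaBody` with the twist FACTORED instead of lifted:
the value law is discharged from `hbody` (PK-4a `ZetaValueCharSum.charSum_eq_of_even`, depletion modulus `p·A`),
the integrality of the symbols from `hf`/`hp2`/`hirr`, `ℓ_q ∤ N`, `(pA, n) = 1`, `a_{ℓ_q} ∈ ℤ` and the lifts `λ_q`
inside; displayed: the avatar `X`, the embedding unit `u`, the rational `κ`, the twist data `(uq, aM, Eq, Cq, Vq)`,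
`b_q ≡ 1` off `ℓ_q`, `p^K ∣ ℓ_q − 1`, `Θ` (PK-3's `hΘ`), and the FACTORISATION `c₁ • Vq = P_ℚ · Vq′` with integral
lifts `P`, `V′`.  Output: `∏_q D_q · (((c₁·n)•(1+δ₋₁)X)^{ℚ_p} − (Θ·(P·V′))^{ℚ_p}) = (P·Y)^{ℚ_p}`, `Y ∈ p^K ℤ_p[(ℤ/n)ˣ]`.
[cite: Kato2004Asterisque, Thm. 6.6 (1) (p. 163), §6.2 (p. 161) and Thm. 9.7 (p. 189)]
[cite: Kim2022StructureSelmer, the proof of Thm. 3.13 (arXiv v3 pp. 26–28; = Thm. 3.11 of AJM 148)] -/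
theorem prod_deriv_mul_plusAvatar_sub_eq_factor_mul_of_zetaBody
    (hbody : ZetaBody W p f ι κ Λ c d a A z x) (hf : IsNewformOf W f) (hp2 : p ≠ 2)
    (hirr : W.HasIrreducibleModPGaloisRep p)
    (r : (cyclotomicLevelsRat p (badPlaces c d A N)).Ideals) (d' : ℤ)
    (hcd : Int.gcd (c * d) (cycLevel p 0 r.1 * A) = 1) (hdd' : d * d' ≡ 1 [ZMOD (A : ℤ)])
    (uκ : ℚ) (hκ : (uκ : ℝ) = κ)
    (u : (ZMod (cycLevel p 0 r.1))ˣ)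
    (hι : ι (cycLevel p 0 r.1) (IsCyclotomicExtension.zeta (cycLevel p 0 r.1) ℚ
        (CyclotomicField (cycLevel p 0 r.1) ℚ)) =
      Complex.exp (2 * Real.pi * Complex.I * ((u : ZMod (cycLevel p 0 r.1)).val : ℂ) / (cycLevel p 0 r.1)))
    (X : MonoidAlgebra ℚ (ZMod (cycLevel p 0 r.1))ˣ)
    (hxX : x 0 r = ∑ g : (ZMod (cycLevel p 0 r.1))ˣ, X.coeff g •
      sigma (cycLevel p 0 r.1) g (IsCyclotomicExtension.zeta (cycLevel p 0 r.1) ℚ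
        (CyclotomicField (cycLevel p 0 r.1) ℚ)))
    (b : HeightOneSpectrum (𝓞 ℚ) → (ZMod (cycLevel p 0 r.1))ˣ)
    (hb : ∀ q ∈ r.1, ∀ ℓ' (hℓ' : ℓ' ∈ (cycLevel p 0 r.1).primeFactors),
      ℓ' ≠ ((primesEquiv q : Nat.Primes) : ℕ) → ZMod.unitsMap (Nat.dvd_of_mem_primeFactors hℓ') (b q) = 1)
    (uq : ℕ → (ZMod (cycLevel p 0 r.1))ˣ)
    (huq : ∀ q ∈ (p * A).primeFactors, ((uq q : (ZMod (cycLevel p 0 r.1))ˣ) : ZMod (cycLevel p 0 r.1)) = q)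
    (aM : ℕ → ℤ) (haM : ∀ q ∈ (p * A).primeFactors, cuspCoeff f q = aM q)
    (Eq : MonoidAlgebra ℚ (ZMod (cycLevel p 0 r.1))ˣ)
    (hEq : Eq = ∏ q ∈ (p * A).primeFactors, (1 - single (uq q)⁻¹ ((aM q : ℚ) / q) +
      single ((uq q)⁻¹ ^ 2) (if q ∣ N then 0 else (1 / q : ℚ))))
    (uc ud : (ZMod (cycLevel p 0 r.1))ˣ) (huc : (uc : ZMod (cycLevel p 0 r.1)) = c)
    (hud : (ud : ZMod (cycLevel p 0 r.1)) = d)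
    (Cq : MonoidAlgebra ℚ (ZMod (cycLevel p 0 r.1))ˣ)
    (hCq : Cq = algebraMap ℚ _ ((c : ℚ) ^ 2 * (d : ℚ) ^ 2 * ratMinusSymbol f ((a : ℚ) / A)) -
      single uc ((c : ℚ) * (d : ℚ) ^ 2 * ratMinusSymbol f ((a * c : ℚ) / A)) -
      single ud ((c : ℚ) ^ 2 * (d : ℚ) * ratMinusSymbol f ((a * d' : ℚ) / A)) +
      single (uc * ud) ((c : ℚ) * (d : ℚ) * ratMinusSymbol f ((a * c * d' : ℚ) / A)))
    (Vq : MonoidAlgebra ℚ (ZMod (cycLevel p 0 r.1))ˣ)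
    (hVq : Vq = (1 + single (-1 : (ZMod (cycLevel p 0 r.1))ˣ) (1 : ℚ)) * single u⁻¹ uκ * Eq * Cq)
    (K : ℕ) (hK : ∀ q ∈ r.1, p ^ K ∣ ((primesEquiv q : Nat.Primes) : ℕ) - 1)
    (Θ : MonoidAlgebra ℤ_[p] (ZMod (cycLevel p 0 r.1))ˣ)
    (hΘ : ∀ g : (ZMod (cycLevel p 0 r.1))ˣ, ((Θ.coeff g : ℤ_[p]) : ℚ_[p]) =
      ((ratPlusSymbol f (((g : ZMod (cycLevel p 0 r.1)).val : ℚ) / (cycLevel p 0 r.1)) : ℚ) : ℚ_[p]))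
    -- the twist FACTORED: `c₁ • Vq = P_ℚ · Vq′`, with integral lifts `P` of `P_ℚ` and `V′` of `Vq′`
    (c₁ : ℚ) (Pq Vq' : MonoidAlgebra ℚ (ZMod (cycLevel p 0 r.1))ˣ) (hfac : algebraMap ℚ _ c₁ * Vq = Pq * Vq')
    (P V' : MonoidAlgebra ℤ_[p] (ZMod (cycLevel p 0 r.1))ˣ)
    (hP : MonoidAlgebra.mapRingHom (ZMod (cycLevel p 0 r.1))ˣ (PadicInt.Coe.ringHom (p := p)) P =
      MonoidAlgebra.mapRingHom (ZMod (cycLevel p 0 r.1))ˣ (algebraMap ℚ ℚ_[p]) Pq)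
    (hV' : MonoidAlgebra.mapRingHom (ZMod (cycLevel p 0 r.1))ˣ (PadicInt.Coe.ringHom (p := p)) V' =
      MonoidAlgebra.mapRingHom (ZMod (cycLevel p 0 r.1))ˣ (algebraMap ℚ ℚ_[p]) Vq') :
    ∃ Y ∈ Ideal.span {((p : MonoidAlgebra ℤ_[p] (ZMod (cycLevel p 0 r.1))ˣ)) ^ K},
      (∏ q ∈ r.1, ∑ j : Fin (((primesEquiv q : Nat.Primes) : ℕ) - 1),
          MonoidAlgebra.single (b q ^ (j : ℕ)) ((j : ℕ) : ℚ_[p])) *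
          (MonoidAlgebra.mapRingHom (ZMod (cycLevel p 0 r.1))ˣ (algebraMap ℚ ℚ_[p])
              ((c₁ * cycLevel p 0 r.1 : ℚ) •
                ((1 + MonoidAlgebra.single (-1 : (ZMod (cycLevel p 0 r.1))ˣ) (1 : ℚ)) * X)) -
            MonoidAlgebra.mapRingHom (ZMod (cycLevel p 0 r.1))ˣ (PadicInt.Coe.ringHom (p := p))
              (Θ * (P * V'))) =
        MonoidAlgebra.mapRingHom (ZMod (cycLevel p 0 r.1))ˣ (PadicInt.Coe.ringHom (p := p)) (P * Y) := by
  classical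
  -- the enumeration of the primes of the level `n = cycLevel p 0 r` by the places of `r`
  let ℓ : ↥r.1 → ℕ := fun i => ((primesEquiv (i : HeightOneSpectrum (𝓞 ℚ)) : Nat.Primes) : ℕ)
  haveI hℓ : ∀ i, Fact (ℓ i).Prime := fun i => ⟨(primesEquiv (i : HeightOneSpectrum (𝓞 ℚ))).2⟩
  have hinj : Function.Injective ℓ := fun i j h =>
    Subtype.ext (primesEquiv.injective (Subtype.ext h))
  have hn : ∏ i, ℓ i = cycLevel p 0 r.1 := by
    rw [TameLevel.cycLevel_zero_eq_prod, ← Finset.prod_coe_sort r.1]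
  have hsq : Squarefree (cycLevel p 0 r.1) := TameLevel.squarefree_cycLevel_zero p r.1
  -- the usable places avoid `2cdpAN`
  have hprim : ∀ i : ↥r.1, ¬ ℓ i ∣ 2 * c.natAbs * d.natAbs * A * N ∧ ℓ i ≠ p := fun i =>
    (mem_primes_cyclotomicLevelsRat_badPlaces_iff p c d A N i.1).mp (r.2 i.1 i.2)
  have hℓN : ∀ i, ¬ ℓ i ∣ N := fun i h => (hprim i).1 (dvd_mul_of_dvd_right h _)
  have hℓA : ∀ i, ¬ ℓ i ∣ A := fun i h =>
    (hprim i).1 (dvd_mul_of_dvd_left (dvd_mul_of_dvd_right h _) _)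
  have hM0 : p * A ≠ 0 := mul_ne_zero (Fact.out : p.Prime).ne_zero (NeZero.ne A)
  have hM : (p * A).Coprime (cycLevel p 0 r.1) := by
    rw [← hn]
    refine Nat.Coprime.prod_right fun i _ => Nat.Coprime.mul_left ?_ ?_
    · exact (Nat.coprime_primes Fact.out (hℓ i).out).mpr (hprim i).2.symm
    · exact ((Nat.Prime.coprime_iff_not_dvd (hℓ i).out).mpr (hℓA i)).symm
  have hnN : (cycLevel p 0 r.1).Coprime N := by
    rw [← hn]
    exact Nat.Coprime.prod_left fun i _ => (Nat.Prime.coprime_iff_not_dvd (hℓ i).out).mpr (hℓN i)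
  -- integrality of the Hecke eigenvalues and of the plus symbols
  have hQ := hf.coeffField_eq_bot
  choose aℓ ha using fun i : ↥r.1 => hf.1.exists_intCast_eq_cuspCoeff hQ (ℓ i)
  have hint : ∀ m : ℕ, m ∣ cycLevel p 0 r.1 → ∀ t : ℕ, ‖((ratPlusSymbol f ((t : ℚ) / m) : ℚ) : ℚ_[p])‖ ≤ 1 := by
    intro m hm t
    have h := hf.norm_ratPlusSymbol_div_le_one hp2 hirr (Nat.Coprime.coprime_dvd_left hm hnN) (t : ℤ)
    rwa [Int.cast_natCast] at h
  -- the lifts `λ_i ↦ ℓ_i mod n/ℓ_i`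
  have hlamex : ∀ i : ↥r.1, ∃ lam : (ZMod (cycLevel p 0 r.1))ˣ,
      ((ZMod.unitsMap (prod_dvd_of_prod_eq ℓ hn (univ.erase i)) lam : (ZMod (∏ j ∈ univ.erase i, ℓ j))ˣ) :
        ZMod (∏ j ∈ univ.erase i, ℓ j)) = (ℓ i : ZMod (∏ j ∈ univ.erase i, ℓ j)) := by
    intro i
    have hcop : (ℓ i).Coprime (∏ j ∈ univ.erase i, ℓ j) :=
      (Nat.Prime.coprime_iff_not_dvd (hℓ i).out).mpr fun h =>
        ((dvd_prod_erase_iff_not_dvd ℓ hinj hn (hn ▸ Finset.dvd_prod_of_mem ℓ (Finset.mem_univ i)) i).mp h)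
          (dvd_refl _)
    obtain ⟨lam, hlam⟩ := ZMod.unitsMap_surjective (prod_dvd_of_prod_eq ℓ hn (univ.erase i))
      (ZMod.unitOfCoprime (ℓ i) hcop)
    exact ⟨lam, by rw [hlam, ZMod.coe_unitOfCoprime]⟩
  choose lam hlam using hlamex
  -- the derivative units lie in the inertia factors (CRT, T-PK6-VAL FILE 3)
  have hb' : ∀ i : ↥r.1, b i.1 ∈ (ZMod.unitsMap (prod_dvd_of_prod_eq ℓ hn (univ.erase i))).ker := by
    intro i
    haveI : NeZero (∏ j ∈ univ.erase i, ℓ j) := ⟨Finset.prod_ne_zero_iff.mpr fun j _ => (hℓ j).out.ne_zero⟩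
    rw [MonoidHom.mem_ker]
    refine UnitsCRT.units_eq_of_forall_unitsMap_eq _
      (hsq.squarefree_of_dvd (prod_dvd_of_prod_eq ℓ hn (univ.erase i))) _ _ fun ℓ' hℓ' => ?_
    rw [map_one, ← MonoidHom.comp_apply, ZMod.unitsMap_comp]
    have hℓ'n : ℓ' ∈ (cycLevel p 0 r.1).primeFactors :=
      Nat.primeFactors_mono (prod_dvd_of_prod_eq ℓ hn (univ.erase i)) (NeZero.ne _) hℓ'
    refine hb i.1 i.2 ℓ' hℓ'n fun h => ?_
    have hdvd : ℓ i ∣ ∏ j ∈ univ.erase i, ℓ j := by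
      have := Nat.dvd_of_mem_primeFactors hℓ'; rwa [h] at this
    exact ((dvd_prod_erase_iff_not_dvd ℓ hinj hn (hn ▸ Finset.dvd_prod_of_mem ℓ (Finset.mem_univ i)) i).mp
      hdvd) (dvd_refl _)
  -- the value law (PK-4a) with rational `κ`
  have hκ' : (κ : ℂ) = ((uκ : ℚ) : ℂ) := by rw [← hκ, Complex.ofReal_ratCast]
  have hval : ∀ {n₀ : ℕ} [NeZero n₀] (hn₀ : n₀ ∣ cycLevel p 0 r.1) {χ₀ : DirichletCharacter ℂ n₀},
      χ₀.IsPrimitive → χ₀ (-1) = 1 →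
      charSum (cycLevel p 0 r.1) (ι (cycLevel p 0 r.1)) (DirichletCharacter.changeLevel hn₀ χ₀) (x 0 r) =
        ((uκ : ℚ) : ℂ) * ((∏ q ∈ (cycLevel p 0 r.1 * (p * A)).primeFactors.filter (fun q => ¬ q ∣ n₀),
            (1 - χ₀ (q : ZMod n₀) * cuspCoeff f q * (q : ℂ) ^ (-(1 : ℂ)) +
              (if q ∣ N then 0 else (q : ℂ)) * χ₀ (q : ZMod n₀) ^ 2 * ((q : ℂ) ^ (-(1 : ℂ))) ^ 2)) *
          ((∑ b : ZMod n₀, χ₀⁻¹ b * ((ratPlusSymbol f ((b.val : ℚ) / n₀) : ℚ) : ℂ)) /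
            gaussSum χ₀⁻¹ (ZMod.stdAddChar (N := n₀)))) *
        cuspFactor f true (fun j => (DirichletCharacter.changeLevel hn₀ χ₀)⁻¹ (j : ZMod (cycLevel p 0 r.1)))
          c d a A d' := by
    intro n₀ _ hn₀ χ₀ hχ₀ heven
    rw [← hκ']
    exact ZetaValueCharSum.charSum_eq_of_even W p f ι κ Λ c d a A z x hbody hf.1 hQ 0 r d' hcd hdd' hn₀ hχ₀ heven
  -- the generic congruence at the enumeration `ℓ`
  have h := prod_deriv_mul_plusAvatar_sub_eq_factor_mul ℓ hinj hn f hf.1 hQ hℓN aℓ ha (x 0 r) X hxX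
    (ι (cycLevel p 0 r.1)) u hι
    uκ hM0 hM c d a A d' hval lam hlam (fun i => b i.1) hb'
    (fun i => ∑ h ∈ univ.filter (· ∈ (ZMod.unitsMap (prod_dvd_of_prod_eq ℓ hn (univ.erase i))).ker),
      single h (1 : ℚ))
    (fun i => ∑ j ∈ range (ℓ i - 1), single (b i.1 ^ j) ((j : ℕ) : ℚ))
    (fun i => algebraMap ℚ _ (((ℓ i : ℚ) - 2) / 2))
    (fun i => algebraMap ℚ _ (aℓ i : ℚ) - single (lam i)⁻¹ (1 : ℚ) - single (lam i) (ℓ i : ℚ))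
    (fun i => algebraMap ℚ _ (aℓ i : ℚ) - single (lam i) (1 : ℚ) - single (lam i)⁻¹ (1 : ℚ))
    (fun _ => rfl) (fun _ => rfl) (fun _ => rfl) (fun _ => rfl) (fun _ => rfl)
    uq huq aM haM Eq hEq uc ud huc hud Cq hCq Vq hVq
    (fun e => ∑ g : (ZMod (cycLevel p 0 r.1))ˣ, single g (ratPlusSymbol f
      ((((ZMod.unitsMap (prod_dvd_of_prod_eq ℓ hn e) g : (ZMod (∏ i ∈ e, ℓ i))ˣ) :
        ZMod (∏ i ∈ e, ℓ i)).val : ℚ) / (∏ i ∈ e, ℓ i : ℕ))))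
    (fun _ => rfl) p hp2 K (fun i => hK i.1 i.2) hint Θ hΘ c₁ Pq Vq' hfac P V' hP hV'
  rw [← Finset.prod_coe_sort r.1]
  exact h

end OfZetaBody

end Summit.BirchSwinnertonDyer.BirchSwinnertonDyer.Theorems.KimAtThreeShallowEqDeepAnomalousCongruenceOfZetaBody

end
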